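import Summits.ResolutionOfSingularities.ResolutionOfSingularities.Theorems.HomologicalConductorNoZenoSplitGaloisClosure
import Literature.AlgebraicGeometry.Resolution.EtaleLocalAlgebra

/-!
# Galois splitting base, III: the germ `Ŝ = (D[α₁, …, αₙ])_𝔫` and its local-étale bundle

W4.4 (crux `NoZenoR`, stmt-ResolutionOfSingularities-19943), slot 5 `stub_L1wCoreF`, brick
**D2″ (Galois refinement of the splitting base)**, ring side, part 3 (parts 1–2:
`…SplitGaloisRoots`, `…SplitGaloisClosure`). Design adopted by res-L0-w44-stub-2 (BINDER LINE
2026-08-27T18:13:56Z): NO residually-trivial hop; the descent of minimality (BC-4b) runs directly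
over `D → Ŝ`. For `D` an integrally closed LOCAL domain with fraction field `K`, `f ∈ D[X]` monic
with separable reduction, `L` a splitting field of `f` over `K`, `B := integralClosure D L`
(`= D[α⃗]`, finite étale over `D` by part 2) and `𝔫 ⊆ B` any maximal ideal, the germ
`Ŝ := Localization.AtPrime 𝔫` satisfies the LOCAL-ÉTALE BUNDLE of the typed Lipman (16.1)/(16.5)
facts (binders (B0)(B1) of the line): `comap_integralClosure_eq_maximalIdeal` (`𝔫 ∩ D = 𝔪`),
`isLocalHom_…`, `flat_…`, `essFiniteType_…`, `formallyUnramified_…`,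
`map_maximalIdeal_…` (`𝔪_D Ŝ = 𝔪_Ŝ`), `isSeparable_residueField_…`, `finite_residueField_…`,
`isNoetherianRing_…`, `ringKrullDim_…` (`dim Ŝ = dim D`), `isRegularLocalRing_…_iff`,
`isIntegrallyClosed_…` (normal domain). Part 4 (`…SplitGaloisSymmetry`) supplies the finite group
acting on `Ŝ` and the residual surjectivity; part 5 the `Sig.L1Core`/D2′-currency package.

Everything is PROVED; no definitions, no named facts. All statements are [folklore]
(EGA IV 18.4; Bourbaki, *Alg. Comm.* V §2; Matsumura Thms. 15.1, 23.7 via the tree's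
`EtaleLocalAlgebra`).

OURS (cell res-hironaka, chain W4.4); AI-written, weaker than expert review; nothing here is a
statement of the manuscript under review.
-/

noncomputable section

set_option linter.dupNamespace false

open Polynomial

namespace Summit.ResolutionOfSingularities.ResolutionOfSingularities.Theorems.NoZeno.SplittingBase

universe u

/-! ## The Galois splitting germ `Ŝ = (D[α₁, …, αₙ])_𝔫`: local-étale bundle over `D` -/

section Germ

variable {D K L : Type u} [CommRing D] [IsDomain D] [IsIntegrallyClosed D] [IsLocalRing D]
  [Field K] [Algebra D K] [IsFractionRing D K] [Field L] [Algebra K L] [Algebra D L]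
  [IsScalarTower D K L]

omit [IsDomain D] [IsIntegrallyClosed D] in
/-- Every maximal ideal of the integral closure of the local `D` in `L` lies over `𝔪_D`.
[folklore] -/
theorem comap_integralClosure_eq_maximalIdeal (𝔫 : Ideal (integralClosure D L)) [𝔫.IsMaximal] :
    𝔫.comap (algebraMap D (integralClosure D L)) = IsLocalRing.maximalIdeal D :=
  IsLocalRing.eq_maximalIdeal (Ideal.isMaximal_comap_of_isIntegral_of_isMaximal 𝔫)

omit [IsDomain D] [IsIntegrallyClosed D] [IsLocalRing D] in
/-- The integral closure of `D` in a field `L ⊇ D` has a maximal ideal. [folklore] -/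
theorem exists_isMaximal_integralClosure :
    ∃ 𝔫 : Ideal (integralClosure D L), 𝔫.IsMaximal :=
  Ideal.exists_maximal _

omit [IsDomain D] [IsIntegrallyClosed D] in
/-- `D → (integral closure)_𝔫` is a local homomorphism. [folklore] -/
theorem isLocalHom_algebraMap_localization_integralClosure (𝔫 : Ideal (integralClosure D L))
    [𝔫.IsMaximal] : IsLocalHom (algebraMap D (Localization.AtPrime 𝔫)) := by
  constructor
  intro d hd
  rw [IsScalarTower.algebraMap_apply D (integralClosure D L) (Localization.AtPrime 𝔫),
    IsLocalization.AtPrime.isUnit_to_map_iff (Localization.AtPrime 𝔫) 𝔫] at hd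
  by_contra hnu
  have hmem : d ∈ IsLocalRing.maximalIdeal D := hnu
  rw [← comap_integralClosure_eq_maximalIdeal (L := L) 𝔫, Ideal.mem_comap] at hmem
  exact hd hmem

/-- **Flatness**: `Ŝ = (D[α⃗])_𝔫` is flat over `D` (finite étale, then localisation).
[folklore] -/
theorem flat_localization_integralClosure {f : D[X]} (hf : f.Monic)
    (hsep : (f.map (IsLocalRing.residue D)).Separable)
    [Polynomial.IsSplittingField K L (f.map (algebraMap D K))]
    (𝔫 : Ideal (integralClosure D L)) [𝔫.IsMaximal] :
    Module.Flat D (Localization.AtPrime 𝔫) := by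
  haveI : Algebra.Etale D (integralClosure D L) :=
    etale_integralClosure hf (splits_map_of_isSplittingField (K := K) f) hsep
      (adjoin_rootSet_eq_top_of_isSplittingField (K := K) f)
  exact Module.Flat.trans D (integralClosure D L) (Localization.AtPrime 𝔫)

/-- `Ŝ` is essentially of finite type over `D`. [folklore] -/
theorem essFiniteType_localization_integralClosure {f : D[X]} (hf : f.Monic)
    (hsep : (f.map (IsLocalRing.residue D)).Separable)
    [Polynomial.IsSplittingField K L (f.map (algebraMap D K))]
    (𝔫 : Ideal (integralClosure D L)) [𝔫.IsMaximal] :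
    Algebra.EssFiniteType D (Localization.AtPrime 𝔫) := by
  haveI : Module.Finite D (integralClosure D L) :=
    finite_integralClosure hf (splits_map_of_isSplittingField (K := K) f) hsep
      (adjoin_rootSet_eq_top_of_isSplittingField (K := K) f)
  infer_instance

/-- `Ŝ` is formally unramified over `D`. [folklore] -/
theorem formallyUnramified_localization_integralClosure {f : D[X]} (hf : f.Monic)
    (hsep : (f.map (IsLocalRing.residue D)).Separable)
    [Polynomial.IsSplittingField K L (f.map (algebraMap D K))]
    (𝔫 : Ideal (integralClosure D L)) [𝔫.IsMaximal] :
    Algebra.FormallyUnramified D (Localization.AtPrime 𝔫) := by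
  haveI : Algebra.Etale D (integralClosure D L) :=
    etale_integralClosure hf (splits_map_of_isSplittingField (K := K) f) hsep
      (adjoin_rootSet_eq_top_of_isSplittingField (K := K) f)
  haveI : Algebra.FormallyUnramified (integralClosure D L) (Localization.AtPrime 𝔫) :=
    Algebra.FormallyUnramified.of_isLocalization 𝔫.primeCompl
  exact Algebra.FormallyUnramified.comp D (integralClosure D L) _

/-- **Unramified**: `𝔪_D · Ŝ = 𝔪_Ŝ`. [folklore] -/
theorem map_maximalIdeal_localization_integralClosure {f : D[X]} (hf : f.Monic)
    (hsep : (f.map (IsLocalRing.residue D)).Separable)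
    [Polynomial.IsSplittingField K L (f.map (algebraMap D K))]
    (𝔫 : Ideal (integralClosure D L)) [𝔫.IsMaximal] :
    (IsLocalRing.maximalIdeal D).map (algebraMap D (Localization.AtPrime 𝔫)) =
      IsLocalRing.maximalIdeal (Localization.AtPrime 𝔫) := by
  haveI := isLocalHom_algebraMap_localization_integralClosure (D := D) (L := L) 𝔫
  haveI := essFiniteType_localization_integralClosure (K := K) hf hsep 𝔫
  haveI := formallyUnramified_localization_integralClosure (K := K) hf hsep 𝔫
  exact Algebra.FormallyUnramified.map_maximalIdeal

/-- **Separable residue extension** `κ(Ŝ)/κ(D)`. [folklore] -/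
theorem isSeparable_residueField_localization_integralClosure {f : D[X]} (hf : f.Monic)
    (hsep : (f.map (IsLocalRing.residue D)).Separable)
    [Polynomial.IsSplittingField K L (f.map (algebraMap D K))]
    (𝔫 : Ideal (integralClosure D L)) [𝔫.IsMaximal]
    [IsLocalHom (algebraMap D (Localization.AtPrime 𝔫))] :
    Algebra.IsSeparable (IsLocalRing.ResidueField D)
      (IsLocalRing.ResidueField (Localization.AtPrime 𝔫)) := by
  haveI := essFiniteType_localization_integralClosure (K := K) hf hsep 𝔫
  haveI := formallyUnramified_localization_integralClosure (K := K) hf hsep 𝔫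
  infer_instance

/-- **Finite residue extension** `κ(Ŝ)/κ(D)`. [folklore] -/
theorem finite_residueField_localization_integralClosure {f : D[X]} (hf : f.Monic)
    (hsep : (f.map (IsLocalRing.residue D)).Separable)
    [Polynomial.IsSplittingField K L (f.map (algebraMap D K))]
    (𝔫 : Ideal (integralClosure D L)) [𝔫.IsMaximal]
    [IsLocalHom (algebraMap D (Localization.AtPrime 𝔫))] :
    Module.Finite (IsLocalRing.ResidueField D)
      (IsLocalRing.ResidueField (Localization.AtPrime 𝔫)) := by
  haveI := essFiniteType_localization_integralClosure (K := K) hf hsep 𝔫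
  haveI := formallyUnramified_localization_integralClosure (K := K) hf hsep 𝔫
  infer_instance

/-- `Ŝ` is Noetherian when `D` is. [folklore] -/
theorem isNoetherianRing_localization_integralClosure [IsNoetherianRing D] {f : D[X]}
    (hf : f.Monic) (hsep : (f.map (IsLocalRing.residue D)).Separable)
    [Polynomial.IsSplittingField K L (f.map (algebraMap D K))]
    (𝔫 : Ideal (integralClosure D L)) [𝔫.IsMaximal] :
    IsNoetherianRing (Localization.AtPrime 𝔫) := by
  haveI : Module.Finite D (integralClosure D L) :=
    finite_integralClosure hf (splits_map_of_isSplittingField (K := K) f) hsep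
      (adjoin_rootSet_eq_top_of_isSplittingField (K := K) f)
  haveI : IsNoetherianRing (integralClosure D L) :=
    Algebra.FiniteType.isNoetherianRing D (integralClosure D L)
  exact IsLocalization.isNoetherianRing 𝔫.primeCompl _ inferInstance

/-- **`dim Ŝ = dim D`**. [folklore] -/
theorem ringKrullDim_localization_integralClosure [IsNoetherianRing D] {f : D[X]}
    (hf : f.Monic) (hsep : (f.map (IsLocalRing.residue D)).Separable)
    [Polynomial.IsSplittingField K L (f.map (algebraMap D K))]
    (𝔫 : Ideal (integralClosure D L)) [𝔫.IsMaximal] :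
    ringKrullDim (Localization.AtPrime 𝔫) = ringKrullDim D := by
  haveI := isLocalHom_algebraMap_localization_integralClosure (D := D) (L := L) 𝔫
  haveI := essFiniteType_localization_integralClosure (K := K) hf hsep 𝔫
  haveI := formallyUnramified_localization_integralClosure (K := K) hf hsep 𝔫
  haveI := flat_localization_integralClosure (K := K) hf hsep 𝔫
  haveI := isNoetherianRing_localization_integralClosure (K := K) hf hsep 𝔫
  exact Literature.AlgebraicGeometry.Resolution.ringKrullDim_eq_of_etaleLocal D _

/-- **Regularity is invariant** along `D → Ŝ`. [folklore] -/
theorem isRegularLocalRing_localization_integralClosure_iff [IsNoetherianRing D] {f : D[X]}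
    (hf : f.Monic) (hsep : (f.map (IsLocalRing.residue D)).Separable)
    [Polynomial.IsSplittingField K L (f.map (algebraMap D K))]
    (𝔫 : Ideal (integralClosure D L)) [𝔫.IsMaximal] :
    IsRegularLocalRing (Localization.AtPrime 𝔫) ↔ IsRegularLocalRing D := by
  haveI := isLocalHom_algebraMap_localization_integralClosure (D := D) (L := L) 𝔫
  haveI := essFiniteType_localization_integralClosure (K := K) hf hsep 𝔫
  haveI := formallyUnramified_localization_integralClosure (K := K) hf hsep 𝔫
  haveI := flat_localization_integralClosure (K := K) hf hsep 𝔫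
  haveI := isNoetherianRing_localization_integralClosure (K := K) hf hsep 𝔫
  exact Literature.AlgebraicGeometry.Resolution.isRegularLocalRing_iff_of_etaleLocal D _

omit [IsIntegrallyClosed D] [IsLocalRing D] in
/-- **`Ŝ` is a normal domain** (`L/K` finite). [folklore] -/
theorem isIntegrallyClosed_localization_integralClosure [FiniteDimensional K L]
    (𝔫 : Ideal (integralClosure D L)) [𝔫.IsMaximal] :
    IsIntegrallyClosed (Localization.AtPrime 𝔫) := by
  haveI := integralClosure.isIntegrallyClosedOfFiniteExtension (R := D) K (L := L)
  exact isIntegrallyClosed_of_isLocalization (Localization.AtPrime 𝔫) 𝔫.primeCompl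
    (le_nonZeroDivisors_of_noZeroDivisors fun h => h (Ideal.zero_mem 𝔫))

end Germ

end Summit.ResolutionOfSingularities.ResolutionOfSingularities.Theorems.NoZeno.SplittingBase

end
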